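import Summits.Ventures.PercRepro.C041BlockMapBlockTree
import Summits.Ventures.PercRepro.C041BlockMapExitFamilies

/-!
# ROW C-041 — THEOREM (CUT VERTEX): a host separated by a vertex is the hanging of its far side at the cut vertex of
its near side; CONJECTURE (BLOCK MAP) reduces to the two sides (p6, gen 37)

A SEPARATION of an unmarked host `Z` (vertices `V`, edges `E`): a decidable set `A` of vertices containing the anchor
`a` and a vertex `v ∈ A` such that every edge has both ends in `A` or both ends in `Aᶜ ∪ {v}` (`Sep`) — `v` is a cut
vertex (or the separation is trivial).  THE NEAR SIDE `sideA` is the host on `A` with the edges inside `A`; THE FAR SIDE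
`sideB` is the host on `Option Aᶜ` (the anchor `none` standing for `v`) with the other edges.  THEOREM
(`iso_hangAt_sides`): `Z` is isomorphic to `hangAt sideA sideB ⟨v, _⟩ none` (`C041BlockMapBlockTree`) — the far side
hung at `v`.  **THEOREM (CUT VERTEX)** (`coneHost_of_sep`): for a family of exits `u`, `Z` is a cone host as soon as
the near side is one with the exits of `u` in `A` and the EXTRA exit `v`, and the far side is one with the exits of
`u` outside `A` (anchored at `v`); for every family (`coneHostAll_of_sep`): `ConeHostAll sideA a → ConeHostAll sideB
none → ConeHostAll Z a`.  This is THEOREM (HANG) read on an arbitrary host with a cut vertex — the step that iterates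
along the block–cut tree; the existence of the decomposition (every host is block-grown from its blocks) is not
formalised, this theorem supplies each step of it.
-/

namespace PercRepro

namespace ZoneZ

namespace MultiExit

open ZoneData Pendant Finset TwoExit TreeClosure

section Sep

variable {V E : Type} (Z : ZoneData V E Empty Empty) [DecidableEq V] (A : V → Prop) [DecidablePred A] (v : V)

/-- An edge inside `A`. -/
abbrev InA (e : E) : Prop := A (Z.fst e) ∧ A (Z.snd e)

/-- A SEPARATION at `v`: every edge lies inside `A` or inside `Aᶜ ∪ {v}`. -/
def Sep : Prop := ∀ e, InA Z A e ∨ ((¬ A (Z.fst e) ∨ Z.fst e = v) ∧ (¬ A (Z.snd e) ∨ Z.snd e = v))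

/-- THE NEAR SIDE: the host on `A` with the edges inside `A`. -/
def sideA : ZoneData {x // A x} {e // InA Z A e} Empty Empty where
  fst := fun e => ⟨Z.fst e.1, e.2.1⟩
  snd := fun e => ⟨Z.snd e.1, e.2.2⟩
  at₁ := Empty.elim
  at₂ := Empty.elim

/-- The far side's vertex of a vertex of `Z`: `none` for the vertices of `A` (only `v` occurs), the vertex itself
otherwise. -/
def toB (x : V) : Option {x // ¬ A x} := if h : A x then none else some ⟨x, h⟩

/-- THE FAR SIDE: the host on `Option Aᶜ` (the anchor `none` standing for `v`) with the edges not inside `A`. -/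
def sideB : ZoneData (Option {x // ¬ A x}) {e // ¬ InA Z A e} Empty Empty where
  fst := fun e => toB A (Z.fst e.1)
  snd := fun e => toB A (Z.snd e.1)
  at₁ := Empty.elim
  at₂ := Empty.elim

variable (hv : A v)

/-- The vertices of `Z` as the vertices of the hanging of the far side at `v`. -/
def sidesVertex (x : V) : {x // A x} ⊕ {y : Option {x // ¬ A x} // y ≠ none} :=
  if h : A x then Sum.inl ⟨x, h⟩ else Sum.inr ⟨some ⟨x, h⟩, Option.some_ne_none _⟩

/-- The inverse. -/
def sidesVertexInv : {x // A x} ⊕ {y : Option {x // ¬ A x} // y ≠ none} → V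
  | Sum.inl x => x.1
  | Sum.inr ⟨none, h⟩ => absurd rfl h
  | Sum.inr ⟨some y, _⟩ => y.1

omit [DecidableEq V] [DecidablePred A] in
/-- The inverse, on a far-side vertex. -/
theorem sidesVertexInv_inr_some (y : {x // ¬ A x}) (h : (some y : Option {x // ¬ A x}) ≠ none) :
    sidesVertexInv A (Sum.inr ⟨some y, h⟩) = y.1 := rfl

omit [DecidableEq V] [DecidablePred A] in
/-- The inverse, on a near-side vertex. -/
theorem sidesVertexInv_inl (x : {x // A x}) : sidesVertexInv A (Sum.inl x) = x.1 := rfl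

omit [DecidableEq V] in
/-- The vertex map, on a vertex of `A`. -/
theorem sidesVertex_of_pos {x : V} (h : A x) : sidesVertex A x = Sum.inl ⟨x, h⟩ := by
  unfold sidesVertex
  rw [dif_pos h]

omit [DecidableEq V] in
/-- The vertex map, on a vertex outside `A`. -/
theorem sidesVertex_of_neg {x : V} (h : ¬ A x) :
    sidesVertex A x = Sum.inr ⟨some ⟨x, h⟩, Option.some_ne_none _⟩ := by
  unfold sidesVertex
  rw [dif_neg h]

/-- The vertex equivalence of the decomposition. -/
def sidesEquiv : V ≃ {x // A x} ⊕ {y : Option {x // ¬ A x} // y ≠ none} where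
  toFun := sidesVertex A
  invFun := sidesVertexInv A
  left_inv := by
    intro x
    by_cases h : A x
    · rw [sidesVertex_of_pos A h, sidesVertexInv_inl]
    · rw [sidesVertex_of_neg A h, sidesVertexInv_inr_some]
  right_inv := by
    rintro (⟨x, hx⟩ | ⟨_ | ⟨y, hy⟩, h⟩)
    · rw [sidesVertexInv_inl, sidesVertex_of_pos A hx]
    · exact absurd rfl h
    · rw [sidesVertexInv_inr_some, sidesVertex_of_neg A hy]

/-- The edge equivalence of the decomposition: the edges inside `A` and the others. -/
def sidesEdgeEquiv : E ≃ {e // InA Z A e} ⊕ {e // ¬ InA Z A e} := (Equiv.sumCompl (InA Z A)).symm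

/-- The first end of an edge inside `A` corresponds. -/
theorem sides_fst_inA (e : E) (h : InA Z A e) :
    (hangAt (sideA Z A) (sideB Z A) ⟨v, hv⟩ none).fst (Sum.inl ⟨e, h⟩) = sidesVertex A (Z.fst e) := by
  show Sum.inl ⟨Z.fst e, h.1⟩ = sidesVertex A (Z.fst e)
  rw [sidesVertex_of_pos A h.1]

/-- The second end of an edge inside `A` corresponds. -/
theorem sides_snd_inA (e : E) (h : InA Z A e) :
    (hangAt (sideA Z A) (sideB Z A) ⟨v, hv⟩ none).snd (Sum.inl ⟨e, h⟩) = sidesVertex A (Z.snd e) := by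
  show Sum.inl ⟨Z.snd e, h.2⟩ = sidesVertex A (Z.snd e)
  rw [sidesVertex_of_pos A h.2]

/-- An end of a far-side edge, through the redirection, is the vertex itself. -/
theorem redH_toB (x : V) (hx : ¬ A x ∨ x = v) : redH ⟨v, hv⟩ none (toB A x) = sidesVertex A x := by
  rcases hx with hx | rfl
  · rw [sidesVertex_of_neg A hx]
    unfold toB
    rw [dif_neg hx, redH_of_ne]
  · rw [sidesVertex_of_pos A hv]
    unfold toB
    rw [dif_pos hv]
    unfold redH
    rw [dif_pos rfl]

/-- The first end of a far-side edge corresponds. -/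
theorem sides_fst_notInA (hsep : Sep Z A v) (e : E) (h : ¬ InA Z A e) :
    (hangAt (sideA Z A) (sideB Z A) ⟨v, hv⟩ none).fst (Sum.inr ⟨e, h⟩) = sidesVertex A (Z.fst e) := by
  show redH ⟨v, hv⟩ none (toB A (Z.fst e)) = sidesVertex A (Z.fst e)
  exact redH_toB A v hv _ ((hsep e).resolve_left h).1

/-- The second end of a far-side edge corresponds. -/
theorem sides_snd_notInA (hsep : Sep Z A v) (e : E) (h : ¬ InA Z A e) :
    (hangAt (sideA Z A) (sideB Z A) ⟨v, hv⟩ none).snd (Sum.inr ⟨e, h⟩) = sidesVertex A (Z.snd e) := by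
  show redH ⟨v, hv⟩ none (toB A (Z.snd e)) = sidesVertex A (Z.snd e)
  exact redH_toB A v hv _ ((hsep e).resolve_left h).2

/-- The ends correspond through the decomposition. -/
theorem sides_fst (hsep : Sep Z A v) (e : E) :
    (hangAt (sideA Z A) (sideB Z A) ⟨v, hv⟩ none).fst (sidesEdgeEquiv Z A e) = sidesVertex A (Z.fst e) := by
  unfold sidesEdgeEquiv
  by_cases h : InA Z A e
  · rw [Equiv.sumCompl_symm_apply_of_pos (p := InA Z A) h]
    exact sides_fst_inA Z A v hv e h
  · rw [Equiv.sumCompl_symm_apply_of_neg (p := InA Z A) h]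
    exact sides_fst_notInA Z A v hv hsep e h

/-- The ends correspond through the decomposition. -/
theorem sides_snd (hsep : Sep Z A v) (e : E) :
    (hangAt (sideA Z A) (sideB Z A) ⟨v, hv⟩ none).snd (sidesEdgeEquiv Z A e) = sidesVertex A (Z.snd e) := by
  unfold sidesEdgeEquiv
  by_cases h : InA Z A e
  · rw [Equiv.sumCompl_symm_apply_of_pos (p := InA Z A) h]
    exact sides_snd_inA Z A v hv e h
  · rw [Equiv.sumCompl_symm_apply_of_neg (p := InA Z A) h]
    exact sides_snd_notInA Z A v hv hsep e h

/-- **THEOREM (DECOMPOSITION AT A CUT VERTEX)**: the incidences of `Z` are those of the far side hung at `v` of the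
near side, through the vertex and edge equivalences. -/
theorem sides_joins_iff (hsep : Sep Z A v) (e : E) (x y : V) :
    (hangAt (sideA Z A) (sideB Z A) ⟨v, hv⟩ none).Joins (sidesEdgeEquiv Z A e) (sidesEquiv A x) (sidesEquiv A y) ↔
      Z.Joins e x y := by
  unfold ZoneData.Joins
  rw [sides_fst Z A v hv hsep, sides_snd Z A v hv hsep]
  show (sidesVertex A (Z.fst e) = sidesVertex A x ∧ sidesVertex A (Z.snd e) = sidesVertex A y) ∨
    (sidesVertex A (Z.fst e) = sidesVertex A y ∧ sidesVertex A (Z.snd e) = sidesVertex A x) ↔ _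
  have hinj : Function.Injective (sidesVertex A) := (sidesEquiv A).injective
  rw [hinj.eq_iff, hinj.eq_iff, hinj.eq_iff, hinj.eq_iff]

variable [Fintype E] [DecidableEq E] (a : V) (ha : A a)

/-- The block map of `Z` is the block map of the far side hung at `v` of the near side. -/
theorem blockMap_sides (hsep : Sep Z A v) {ι : Type} [Fintype ι] (u : ι → V) (w : ι → Vec6) :
    blockMap Z u a w =
      blockMap (hangAt (sideA Z A) (sideB Z A) ⟨v, hv⟩ none) (sidesEquiv A ∘ u) (sidesEquiv A a) w :=
  (blockMap_iso Z _ (sidesEquiv A) (sidesEdgeEquiv Z A) (sides_joins_iff Z A v hv hsep) u a w).symm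

include hv in
/-- **THEOREM (CUT VERTEX), every family**: a host with a separation is a cone host for every family of exits as soon
as its near side (at the anchor) and its far side (at `v`) are. -/
theorem coneHostAll_of_sep (hsep : Sep Z A v) (hA : ConeHostAll (sideA Z A) ⟨a, ha⟩)
    (hB : ConeHostAll (sideB Z A) none) : ConeHostAll Z a := by
  intro ι _ _ u w hw
  rw [blockMap_sides Z A v hv a hsep]
  have h : ConeHostAll (hangAt (sideA Z A) (sideB Z A) ⟨v, hv⟩ none) (Sum.inl ⟨a, ha⟩) :=
    coneHostAll_hangAt _ _ _ _ _ hA hB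
  have hanchor : sidesEquiv A a = Sum.inl ⟨a, ha⟩ := sidesVertex_of_pos A ha
  rw [hanchor]
  exact h _ w hw

/-- The exits of a family in `A`. -/
def exitsA {ι : Type} (u : ι → V) : {k // A (u k)} → {x // A x} := fun k => ⟨u k.1, k.2⟩

/-- The exits of a family outside `A`, as far-side vertices. -/
def exitsB {ι : Type} (u : ι → V) : {k // ¬ A (u k)} → Option {x // ¬ A x} := fun k => some ⟨u k.1, k.2⟩

/-- The family, through the decomposition, is the split family re-indexed. -/
theorem sidesEquiv_comp_eq {ι : Type} (u : ι → V) :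
    sidesEquiv A ∘ u = (Sum.elim (fun k => Sum.inl (exitsA A u k)) fun k => redH ⟨v, hv⟩ none (exitsB A u k)) ∘
      (Equiv.sumCompl fun k => A (u k)).symm := by
  funext k
  by_cases hk : A (u k)
  · rw [Function.comp_apply, Function.comp_apply, Equiv.sumCompl_symm_apply_of_pos (p := fun k => A (u k)) hk,
      Sum.elim_inl]
    show sidesVertex A (u k) = _
    rw [sidesVertex_of_pos A hk]
    rfl
  · rw [Function.comp_apply, Function.comp_apply, Equiv.sumCompl_symm_apply_of_neg (p := fun k => A (u k)) hk,
      Sum.elim_inr]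
    show sidesVertex A (u k) = _
    unfold exitsB
    rw [sidesVertex_of_neg A hk, redH_of_ne]

/-- **THEOREM (CUT VERTEX)**: for a family of exits `u`, the host is a cone host as soon as the near side is one with
the exits of `u` in `A` and the extra exit `v`, and the far side is one with the exits of `u` outside `A`. -/
theorem coneHost_of_sep (hsep : Sep Z A v) {ι : Type} [Fintype ι] [DecidableEq ι] (u : ι → V)
    (hA : ConeHost (sideA Z A) (uplus (exitsA A u) ⟨v, hv⟩) ⟨a, ha⟩) (hB : ConeHost (sideB Z A) (exitsB A u) none) :
    ConeHost Z u a := by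
  intro w hw
  rw [blockMap_sides Z A v hv a hsep]
  have hanchor : sidesEquiv A a = Sum.inl ⟨a, ha⟩ := sidesVertex_of_pos A ha
  rw [hanchor, sidesEquiv_comp_eq A v hv u]
  have hs : ConeHost (hangAt (sideA Z A) (sideB Z A) ⟨v, hv⟩ none)
      (Sum.elim (fun k => Sum.inl (exitsA A u k)) fun k => redH ⟨v, hv⟩ none (exitsB A u k)) (Sum.inl ⟨a, ha⟩) :=
    coneHost_hangAt_split _ _ _ _ _ _ _ hA hB
  exact coneHost_reindex (Equiv.sumCompl fun k => A (u k)).symm hs w hw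

end Sep

end MultiExit

end ZoneZ

end PercRepro
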